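import Summits.RiemannHypothesis.RiemannHypothesis.Theorems.Splittings.ScrewBlaschkeRigidity
import Summits.RiemannHypothesis.RiemannHypothesis.Theorems.Splittings.ScrewLatticeTowerC
import HarnessLib

/-!
# Moment cancellation forces a non-Blaschke configuration (screw/bridge gen 17, object #5)

Cell `rh-split`, seat `rh-split-screw-bridge` gen 17.  ζ-free and RH-free: pure complex analysis.
Nothing here bears on the truth of RH.

## The theorem

Let `ι` be countable, `w : ι → ℂ` with `‖w i‖ < S` for all `i`, and `b : ι → ℂ` absolutely summable.
Suppose every power moment vanishes: `Σ_i b_i w_i^k = 0` for all `k ≥ 1` («lattice blindness» of the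
discrete datum `Σ_i b_i δ_{w_i}` — exactly the mechanism behind every blind model the cell has built: the
Wolff packing data of `ScrewLatticeWolffData.exists_wolffData` (barriers B14/B16), the divisor-ring atoms of
`ScrewWolffDiscreteData` (B16′) and the rigid polygon tower `ScrewLatticeTowerA.moment_cancel` (B26)).  If the
configuration is BLASCHKE at the radius `S`, i.e. `Σ_i (1 - ‖w_i‖/S) < ∞`, then every fibre charge vanishes:
`Σ_{i : w_i = a} b_i = 0` for every `a ≠ 0` (`fibre_charge_eq_zero`).  Consequently (`not_summable_of_moment_cancel`)
a moment-cancelling family with POSITIVE weights and at least one non-zero point is NON-Blaschke at every strict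
radius bound `S`:  `Σ_i (1 - ‖w_i‖/S) = ∞`; for Wolff data in the tree's shape this is `wolffData_not_blaschke`
(any strict bound) and `wolffData_not_blaschke_sup` (the supremal, non-attained radius); for indexed data in the shape
of `ScrewLatticeTowerC.exists_towerData` it is `indexed_not_blaschke_iSup`; and for the rigid polygon TOWER itself, in
its unit-disc normalisation, `tower_not_blaschke : ¬ Summable (1 - ‖atom c K₀ ·‖)` (§4).

So non-Blaschke accumulation is the PRICE of blindness: the converse companion of B16′
(`ScrewWolffNonBlaschke`, which exhibits non-Blaschke blind data) — every blind configuration of the class, present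
or future, lies on the side excluded by the top-layer Blaschke condition `TopBlaschke` of the row X-BL
(`ScrewBlaschkeSeam.latticeCeiling_and_topBlaschke_iff_rh`).

## Proof

For `S‖u‖ < 1` the double family `b_i (w_i u)^{k+1}` is absolutely summable; its column sums are the moments
(zero), its row sums are `b_i w_i u/(1 - w_i u)`, so the generating function `Σ_i b_i w_i u/(1 - w_i u)` vanishes
(`hasSum_gen`).  Substituting `u = 1/(S z)` with `‖z‖ > 1` turns this into the Borel series
`Σ_i (b_i w_i/S)/(z - w_i/S) = 0` on the exterior of the unit disc, with poles `w_i/S` inside the disc; the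
finite-Blaschke-product rigidity theorem `ScrewBlaschkeRigidity.cluster_charge_eq_zero` (tree, p584414; here with
`g = 0`, `ρ₀ = 0`) kills every cluster charge.  In print the sharp form of this necessity is the
Brown–Shields–Zeller theorem (an absolutely convergent series `Σ c_n/(z - z_n)`, `z_n` in the disc, can vanish
identically outside the disc with some `c_n ≠ 0` iff `{z_n}` is dominating — in particular non-Blaschke),
[Ross–Shapiro, Generalized analytic continuation, AMS ULS 25 (2002), Thm 4.2.12].
-/

set_option linter.dupNamespace false

namespace Summit.RiemannHypothesis.RiemannHypothesis.Theorems.Splittings.ScrewBlaschkeNecessity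

open Complex Filter Topology
open Summit.RiemannHypothesis.RiemannHypothesis.Theorems.Splittings

variable {ι : Type*}

/-! ## 1. The generating function of a moment-cancelling family vanishes -/

/-- The double family `(i, k) ↦ b_i (w_i u)^{k+1}` is summable when `S‖u‖ < 1`. -/
theorem summable_double {w b : ι → ℂ} {S : ℝ} (hS0 : 0 ≤ S) (hS : ∀ i, ‖w i‖ < S)
    (hb : Summable fun i ↦ ‖b i‖) {u : ℂ} (hu : S * ‖u‖ < 1) :
    Summable fun p : ι × ℕ ↦ b p.1 * (w p.1 * u) ^ (p.2 + 1) := by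
  set q : ℝ := S * ‖u‖ with hq
  have hq0 : 0 ≤ q := mul_nonneg hS0 (norm_nonneg u)
  have hgeo : Summable fun k : ℕ ↦ q ^ (k + 1) := by
    simpa [pow_succ] using (summable_geometric_of_lt_one hq0 hu).mul_right q
  refine Summable.of_norm_bounded
    (hb.mul_of_nonneg hgeo (fun i ↦ norm_nonneg _) (fun k ↦ pow_nonneg hq0 _)) ?_
  rintro ⟨i, k⟩
  have hwu : ‖w i‖ * ‖u‖ ≤ q := mul_le_mul_of_nonneg_right (hS i).le (norm_nonneg u)
  simp only [norm_mul, norm_pow]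
  exact mul_le_mul_of_nonneg_left (pow_le_pow_left₀ (by positivity) hwu _) (norm_nonneg _)

/-- Row sums: the geometric series `Σ_k b (w u)^{k+1} = b w u/(1 - w u)`. -/
theorem hasSum_row {w b : ι → ℂ} {S : ℝ} (hS : ∀ i, ‖w i‖ < S) {u : ℂ} (hu : S * ‖u‖ < 1) (i : ι) :
    HasSum (fun k : ℕ ↦ b i * (w i * u) ^ (k + 1)) (b i * (w i * u) / (1 - w i * u)) := by
  have hwu : ‖w i * u‖ < 1 := by
    rw [norm_mul]
    exact lt_of_le_of_lt (mul_le_mul_of_nonneg_right (hS i).le (norm_nonneg u)) hu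
  have e1 : (fun k : ℕ ↦ b i * (w i * u) ^ (k + 1)) = fun k ↦ b i * (w i * u) * (w i * u) ^ k := by
    funext k; ring
  rw [e1, div_eq_mul_inv]
  exact (hasSum_geometric_of_norm_lt_one hwu).mul_left (b i * (w i * u))

/-- Column sums vanish by moment cancellation. -/
theorem hasSum_col {w b : ι → ℂ} (hmom : ∀ k : ℕ, 1 ≤ k → HasSum (fun i ↦ b i * w i ^ k) 0)
    (u : ℂ) (k : ℕ) : HasSum (fun i ↦ b i * (w i * u) ^ (k + 1)) 0 := by
  have h := (hmom (k + 1) (Nat.le_add_left 1 k)).mul_right (u ^ (k + 1))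
  rw [zero_mul] at h
  have e : (fun i ↦ b i * (w i * u) ^ (k + 1)) = fun i ↦ b i * w i ^ (k + 1) * u ^ (k + 1) := by
    funext i; ring
  rw [e]; exact h

/-- **The generating function vanishes.**  If all moments `Σ_i b_i w_i^k` (`k ≥ 1`) vanish, then
`Σ_i b_i w_i u/(1 - w_i u) = 0` whenever `S‖u‖ < 1`. -/
theorem hasSum_gen {w b : ι → ℂ} {S : ℝ} (hS0 : 0 ≤ S) (hS : ∀ i, ‖w i‖ < S)
    (hb : Summable fun i ↦ ‖b i‖) (hmom : ∀ k : ℕ, 1 ≤ k → HasSum (fun i ↦ b i * w i ^ k) 0)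
    {u : ℂ} (hu : S * ‖u‖ < 1) :
    HasSum (fun i ↦ b i * (w i * u) / (1 - w i * u)) 0 := by
  obtain ⟨a, ha⟩ := summable_double hS0 hS hb hu
  have ha' : HasSum (fun p : ℕ × ι ↦ b p.2 * (w p.2 * u) ^ (p.1 + 1)) a := by
    have h := (Equiv.prodComm ℕ ι).hasSum_iff.mpr ha
    simpa [Function.comp_def] using h
  have hcol : HasSum (fun _ : ℕ ↦ (0 : ℂ)) a := ha'.prod_fiberwise fun k ↦ hasSum_col hmom u k
  have ha0 : a = 0 := hcol.unique hasSum_zero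
  rw [← ha0]
  exact ha.prod_fiberwise fun i ↦ hasSum_row hS hu i

/-! ## 2. Inversion to the exterior of the unit disc and the cluster charges -/

/-- Möbius bookkeeping: with `u = (S z)⁻¹`, `b w u/(1 - w u) = (b w/S)/(z - w/S)` (both sides are the junk
value `0` when `S z = w`). -/
theorem term_inv {b w z S : ℂ} (hS : S ≠ 0) (hz : z ≠ 0) :
    b * (w * (S * z)⁻¹) / (1 - w * (S * z)⁻¹) = b * w / S / (z - w / S) := by
  have h1 : S * z ≠ 0 := mul_ne_zero hS hz
  have h2 : 1 - w * (S * z)⁻¹ = (S * z - w) / (S * z) := by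
    rw [eq_div_iff h1, sub_mul, one_mul, inv_mul_cancel_right₀ h1]
  have h3 : z - w / S = (S * z - w) / S := by
    rw [eq_div_iff hS, sub_mul, div_mul_cancel₀ w hS]; ring
  rw [h2, h3, div_div_eq_mul_div, div_div_eq_mul_div, mul_assoc b, inv_mul_cancel_right₀ h1,
    div_mul_cancel₀ _ hS]

/-- **Fibre charges vanish** (the theorem of this file).  A countable moment-cancelling family with absolutely
summable charges which is Blaschke at the radius `S` (`Σ (1 - ‖w_i‖/S) < ∞`) has zero total charge on every
fibre `{i : w_i = a}`, `a ≠ 0`. -/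
theorem fibre_charge_eq_zero [Countable ι] {w b : ι → ℂ} {S : ℝ}
    (hS : ∀ i, ‖w i‖ < S) (hb : Summable fun i ↦ ‖b i‖)
    (hmom : ∀ k : ℕ, 1 ≤ k → HasSum (fun i ↦ b i * w i ^ k) 0)
    (hbl : Summable fun i ↦ 1 - ‖w i‖ / S) {a : ℂ} (ha : a ≠ 0) :
    ∑' i : {i // w i = a}, b i = 0 := by
  classical
  by_cases hne : Nonempty {i // w i = a}
  swap
  · rw [not_nonempty_iff] at hne
    exact tsum_empty
  obtain ⟨⟨i₀, hi₀⟩⟩ := hne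
  have hS0 : 0 < S := lt_of_le_of_lt (norm_nonneg _) (hS i₀)
  have hSc : (S : ℂ) ≠ 0 := by exact_mod_cast hS0.ne'
  have haS : ‖a‖ < S := hi₀ ▸ hS i₀
  -- the inverted data: poles `w_i/S` in the unit disc, charges `b_i w_i/S`
  set v : ι → ℂ := fun i ↦ w i / S with hv
  set c : ι → ℂ := fun i ↦ b i * w i / S with hc
  have hnS : ∀ x : ℂ, ‖x / (S : ℂ)‖ = ‖x‖ / S := fun x ↦ by
    rw [norm_div, Complex.norm_real, Real.norm_of_nonneg hS0.le]
  have hv1 : ∀ i, ‖v i‖ < 1 := fun i ↦ by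
    simp only [hv, hnS, div_lt_one hS0]; exact hS i
  have hvbl : Summable fun i ↦ 1 - ‖v i‖ := hbl.congr fun i ↦ by simp only [hv, hnS]
  have hcs : Summable fun i ↦ ‖c i‖ := by
    refine Summable.of_nonneg_of_le (fun i ↦ norm_nonneg _) (fun i ↦ ?_) hb
    simp only [hc]
    rw [mul_div_assoc, norm_mul, hnS]
    have : ‖w i‖ / S ≤ 1 := (div_le_one hS0).mpr (hS i).le
    exact mul_le_of_le_one_right (norm_nonneg _) this
  have heq : ∀ z : ℂ, 1 < ‖z‖ → HasSum (fun i ↦ c i / (z - v i)) ((fun _ : ℂ ↦ (0 : ℂ)) z - 0) := by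
    intro z hz
    have hz0 : z ≠ 0 := by
      rintro rfl; rw [norm_zero] at hz; linarith
    have hu : S * ‖((S : ℂ) * z)⁻¹‖ < 1 := by
      rw [norm_inv, norm_mul, Complex.norm_real, Real.norm_of_nonneg hS0.le, mul_inv, ← mul_assoc,
        mul_inv_cancel₀ hS0.ne', one_mul]
      exact inv_lt_one_of_one_lt₀ hz
    have hg := hasSum_gen hS0.le hS hb hmom hu
    simp only [sub_zero]
    convert hg using 1
    funext i
    simp only [hc, hv]
    exact (term_inv hSc hz0).symm
  have ha1 : ‖a / (S : ℂ)‖ < 1 := by rw [hnS, div_lt_one hS0]; exact haS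
  have ha0 : (0 : ℝ) < ‖a / (S : ℂ)‖ := norm_pos_iff.mpr (div_ne_zero ha hSc)
  have key := ScrewBlaschkeRigidity.cluster_charge_eq_zero (w := v) (b := c) (ρ₀ := 0) (g := fun _ : ℂ ↦ (0 : ℂ)) (c₀ := 0)
    le_rfl hv1 hvbl hcs (differentiableOn_const 0) heq ha0 ha1
  -- transport the fibre `{v = a/S}` to `{w = a}` and read off the charge
  have hfib : ∀ i, w i = a ↔ v i = a / S := fun i ↦ by
    simp only [hv]; rw [div_left_inj' hSc]
  have key' : ∑' i : {i // w i = a}, c i = 0 := by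
    have h := (Equiv.subtypeEquivRight hfib).symm.tsum_eq (fun j : {i // w i = a} ↦ c j)
    rw [← h]
    have h2 : (fun j : {i // v i = a / S} ↦ c ((Equiv.subtypeEquivRight hfib).symm j)) =
        fun j : {i // v i = a / S} ↦ c j := by
      funext j; simp
    rw [h2]; exact key
  have hcf : ∀ i : {i // w i = a}, c i = b i * (a / S) := fun i ↦ by
    simp only [hc]; rw [i.2]; ring
  rw [tsum_congr hcf, tsum_mul_right] at key'
  exact (mul_eq_zero.mp key').resolve_right (div_ne_zero ha hSc)

/-! ## 3. Positive weights: blindness forces a non-Blaschke configuration -/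

/-- **Moment cancellation with positive weights forces `Σ (1 - ‖w_i‖/S) = ∞`** for every strict radius bound
`S`, as soon as one point is non-zero. -/
theorem not_summable_of_moment_cancel [Countable ι] {w : ι → ℂ} {α : ι → ℝ} {S : ℝ}
    (hS : ∀ i, ‖w i‖ < S) (hα : ∀ i, 0 < α i) (hαs : Summable α)
    (hmom : ∀ k : ℕ, 1 ≤ k → HasSum (fun i ↦ (α i : ℂ) * w i ^ k) 0) (hex : ∃ i, w i ≠ 0) :
    ¬ Summable fun i ↦ 1 - ‖w i‖ / S := by
  intro hbl
  obtain ⟨i₀, hi₀⟩ := hex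
  have hb : Summable fun i ↦ ‖(α i : ℂ)‖ := by
    refine hαs.congr fun i ↦ ?_
    rw [Complex.norm_real, Real.norm_of_nonneg (hα i).le]
  have h0 := fibre_charge_eq_zero hS hb hmom hbl hi₀
  rw [← Complex.ofReal_tsum] at h0
  have hsub : Summable fun i : {i // w i = w i₀} ↦ α i := hαs.subtype _
  have hpos : 0 < ∑' i : {i // w i = w i₀}, α i :=
    hsub.tsum_pos (fun i ↦ (hα i.1).le) ⟨i₀, rfl⟩ (hα i₀)
  exact hpos.ne' (by exact_mod_cast h0)

/-- **Wolff data are non-Blaschke** (shape of `ScrewLatticeWolffData.exists_wolffData`: countably many `w`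
with `1 < ‖w‖`, positive summable weights, `Σ_w α_w w^k = 0` for all `k ≥ 1`): for EVERY strict bound `S` of
the moduli, `Σ_w (1 - ‖w‖/S) = ∞`. -/
theorem wolffData_not_blaschke {t : Set ℂ} {α : ℂ → ℝ} (ht : t.Countable) (hne : t.Nonempty)
    (h1 : ∀ w ∈ t, 1 < ‖w‖) (hα : ∀ w ∈ t, 0 < α w) (hαs : Summable fun w : t ↦ α w)
    (hmom : ∀ k : ℕ, 1 ≤ k → HasSum (fun w : t ↦ (α w : ℂ) * (w : ℂ) ^ k) 0)
    {S : ℝ} (hS : ∀ w ∈ t, ‖w‖ < S) :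
    ¬ Summable fun w : t ↦ 1 - ‖(w : ℂ)‖ / S := by
  haveI : Countable t := ht.to_subtype
  obtain ⟨w₀, hw₀⟩ := hne
  refine not_summable_of_moment_cancel (w := fun w : t ↦ (w : ℂ)) (α := fun w : t ↦ α w)
    (fun w ↦ hS w w.2) (fun w ↦ hα w w.2) hαs hmom ⟨⟨w₀, hw₀⟩, ?_⟩
  intro h
  have := h1 w₀ hw₀
  have h' : (w₀ : ℂ) = 0 := h
  rw [h', norm_zero] at this
  linarith

/-- **Wolff data are non-Blaschke at their supremal radius.**  With a bound `R` on the moduli and a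
non-attained supremum (the last clause of `exists_wolffData`), `Σ_w (1 - ‖w‖/σ*) = ∞` for
`σ* = sup_w ‖w‖`. -/
theorem wolffData_not_blaschke_sup {t : Set ℂ} {α : ℂ → ℝ} {R : ℝ} (ht : t.Countable) (hne : t.Nonempty)
    (htR : ∀ w ∈ t, 1 < ‖w‖ ∧ ‖w‖ < R) (hα : ∀ w ∈ t, 0 < α w) (hαs : Summable fun w : t ↦ α w)
    (hmom : ∀ k : ℕ, 1 ≤ k → HasSum (fun w : t ↦ (α w : ℂ) * (w : ℂ) ^ k) 0)
    (hsup : ∀ w ∈ t, ∃ w' ∈ t, ‖w‖ < ‖w'‖) :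
    ¬ Summable fun w : t ↦ 1 - ‖(w : ℂ)‖ / sSup ((fun w : ℂ ↦ ‖w‖) '' t) := by
  have hbdd : BddAbove ((fun w : ℂ ↦ ‖w‖) '' t) := by
    refine ⟨R, ?_⟩
    rintro _ ⟨w, hw, rfl⟩
    exact (htR w hw).2.le
  refine wolffData_not_blaschke ht hne (fun w hw ↦ (htR w hw).1) hα hαs hmom fun w hw ↦ ?_
  obtain ⟨w', hw', hlt⟩ := hsup w hw
  exact lt_of_lt_of_le hlt (le_csSup hbdd ⟨w', hw', rfl⟩)

/-! ## 4. Instances: indexed data at their supremal radius, and the rigid polygon tower -/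

/-- **Indexed moment-cancelling data are non-Blaschke at their supremal radius** (shape of
`ScrewLatticeTowerC.exists_towerData` and of the indexed Wolff models): bounded moduli with a non-attained
supremum `σ* = ⨆ i ‖w i‖` give `Σ_i (1 - ‖w_i‖/σ*) = ∞`. -/
theorem indexed_not_blaschke_iSup [Countable ι] {w : ι → ℂ} {α : ι → ℝ} {R : ℝ}
    (hwR : ∀ i, 1 < ‖w i‖ ∧ ‖w i‖ < R) (hα : ∀ i, 0 < α i) (hαs : Summable α)
    (hmom : ∀ k : ℕ, 1 ≤ k → HasSum (fun i ↦ (α i : ℂ) * w i ^ k) 0) (hsup : ∀ i, ∃ j, ‖w i‖ < ‖w j‖)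
    (hne : Nonempty ι) :
    ¬ Summable fun i ↦ 1 - ‖w i‖ / ⨆ j, ‖w j‖ := by
  obtain ⟨i₀⟩ := hne
  have hbdd : BddAbove (Set.range fun j ↦ ‖w j‖) := ⟨R, by rintro _ ⟨j, rfl⟩; exact (hwR j).2.le⟩
  refine not_summable_of_moment_cancel (fun i ↦ ?_) hα hαs hmom ⟨i₀, fun h ↦ ?_⟩
  · obtain ⟨j, hj⟩ := hsup i
    exact lt_of_lt_of_le hj (le_ciSup hbdd j)
  · have := (hwR i₀).1
    rw [h, norm_zero] at this
    linarith

/-- **The rigid polygon tower is non-Blaschke.**  In its unit-disc normalisation (`ScrewLatticeTowerB.atom`: the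
atoms of level `n` lie on the circle of radius `r_n = 1 - 1/(c n)`, positive weights `wt`, all moments `k ≥ 1`
vanish by `ScrewLatticeTowerC.hasSum_moment`), the Blaschke sum diverges: `Σ_i (1 - ‖atom_i‖) = ∞` — so the
tower (barrier candidate B26), like the Wolff packing data, lies on the side excluded by the top-layer Blaschke
condition. -/
theorem tower_not_blaschke {c : ℝ} (hc : 0 < c) (hx : Real.exp (-(1 / c)) ≤ 1 / 18) {K₀ : ℕ}
    (hK : 2 ≤ c * K₀) :
    ¬ Summable fun i : ScrewLatticeTower.Idx c K₀ ↦ 1 - ‖ScrewLatticeTower.atom c K₀ i‖ := by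
  have hK' : 1 < c * K₀ := by linarith
  have hK1 : 1 ≤ K₀ := by
    by_contra h
    have : K₀ = 0 := by omega
    subst this; simp at hK; linarith
  have hlt : ∀ i : ScrewLatticeTower.Idx c K₀, ‖ScrewLatticeTower.atom c K₀ i‖ < 1 := fun i ↦ by
    rw [ScrewLatticeTower.norm_atom hc hK']
    exact ScrewLatticeTower.rad_lt_one hc (hK1.trans (ScrewLatticeTower.le_level i))
  have hex : ∃ i : ScrewLatticeTower.Idx c K₀, ScrewLatticeTower.atom c K₀ i ≠ 0 := by
    refine ⟨Sum.inl ⟨0, hK1⟩, fun h ↦ ?_⟩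
    have hpos : 0 < ‖ScrewLatticeTower.atom c K₀ (Sum.inl ⟨0, hK1⟩)‖ := by
      rw [ScrewLatticeTower.norm_atom hc hK']
      exact ScrewLatticeTower.rad_pos (lt_of_lt_of_le hK' (by
        gcongr; exact ScrewLatticeTower.le_level _))
    rw [h, norm_zero] at hpos
    exact lt_irrefl _ hpos
  have h := not_summable_of_moment_cancel (S := 1) hlt (ScrewLatticeTower.wt_pos hc hK')
    (ScrewLatticeTower.summable_wt hc hx hK) (fun k hk ↦ ScrewLatticeTower.hasSum_moment hc hx hK hk) hex
  simpa using h

end Summit.RiemannHypothesis.RiemannHypothesis.Theorems.Splittings.ScrewBlaschkeNecessity
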